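import Literature.Topology.PlanarFoliations.WalkTracePieces
import Literature.Topology.PlanarFoliations.PathChartSign
import Literature.Topology.PlaneTopology.TraceCrossing
import HarnessLib

/-!
# A straight piece on the trace of the walk around a cycle of distinct separatrices

Topic: Topology / PlanarFoliations, sequel to `WalkBuild.lean` (the walk `walkJ`, `walkℓ` around
a cycle of separatrices), `PolygonLoop.lean` (how the arcs of its polygon meet),
`WalkTracePieces.lean` (where the pieces of the planar trace sit; reparametrised charts),
`PathChartSign.lean` (an injective leafwise path is locally a monotone plaque arc) and
`TraceCrossing.lean` (`StraightPiece`). For a cycle of **pairwise distinct** separatrices (the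
punctures may repeat) we produce a chart `e` of the atlas, a chart `e'` onto the plane with the
same plaques and reparametrised leaf coordinate, and a **straight piece of the trace loop**
`traceLoop walkJ walkℓ m` in `e'` (`exists_straightPiece`): the middle of the last link is a
plaque arc of `e` read monotonically by the leaf coordinate, hence a horizontal chart segment of
`e'`; the rest of the trace — the other links (other leaves), the gates (the punctures, and prong
points on tails of the leaves, which by the leaf order meet the last link only at its ends,
`outArc_eq_linkArc`, `linkArc_eq_inArc`) and the remainder of the last link (injectivity) —
is a compact set missing the segment, so it misses a thin open box around it. The test points of
the straight piece are plaque points of `e` (`exists_straightPiece`, last conjunct), so that they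
can be chosen off countably many leaves (`HugDegree.lean`).

## References

* C. Camacho, A. Lins Neto, *Geometric Theory of Foliations*, Birkhäuser (1985), Ch. VII §2
  [CamachoLinsNeto1985].
-/

noncomputable section

open Set Filter Function Metric unitInterval
open _root_.Topology
open Literature.Topology.FourManifolds Literature.Topology.FourManifolds.Foliation Literature.Topology.PlaneTopology

namespace Literature.Topology.PlanarFoliations

variable {X : Type*} [TopologicalSpace X] [T2Space X] [SecondCountableTopology X] [Nonempty X] {F : Foliation ℝ X} {ι : X → ℂ}
variable {B : Type*} [NormedAddCommGroup B] {M : Type*} [TopologicalSpace M] {T : Foliation B M} {g : ℂ → M}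
variable {hbi : IsBiOriented F}

namespace StarData

variable (D : StarData F ι T g) (hι : IsOpenEmbedding ι)
variable {m : ℕ} [NeZero m] {C : Set ℂ} (hC : IsCompact C) {vtx : Fin m → ℂ} {sx : Fin m → X}
  [hnc : ∀ i, NoncompactSpace (F.Leaf (sx i))]
  (hv : ∀ i, vtx i ∈ D.P) (hmem : ∀ i, ∀ q : F.Leaf (sx i), ι (Leaf.pt q) ∈ C)
  (hω : ∀ i, omegaSet hbi ι (sx i) = {vtx i}) (hα : ∀ i, alphaSet hbi ι (sx (i + 1)) = {vtx i})
  (hsx : ∀ a b, F.leaf (sx a) = F.leaf (sx b) → a = b)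

/-! ## The arcs of the polygon do not meet the interior of a link -/

section Meetings

variable (i : Fin m)

include hsx in
/-- **Incoming prong points are not interior points of a link** (other than its end): a point
`pt jin (b, 0)`, `b ∈ (0, β]`, of the incoming prong at any junction is not a point `ι (cycℓ i w)`
with `w < 1`. [folklore] -/
theorem inPt_ne_linkArc (k : Fin m) {b : ℝ} (hb : b ∈ Ioc 0 (D.jc hι hC hv hmem hω hα k).β) {w : I} (hw : (w : ℝ) < 1) :
    (D.star (vtx k) (D.nprong_vtx_ne_zero hC hv hmem hω k (hbi := hbi))).pt (D.jc hι hC hv hmem hω hα k).Ef.j (b, 0) ≠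
      D.linkArc hι hC hv hmem hω hα i w := by
  intro h
  set E := D.jc hι hC hv hmem hω hα k with hE
  -- the prong point is a leaf point of `sx k`; the link point one of `sx (i + 1)`: `k = i + 1`
  obtain ⟨q, -, hq⟩ := E.Ef.exists_mem_fwd hι (β := b) ⟨hb.1, hb.2.trans E.hβin.2⟩
  have hk : k = i + 1 := by
    apply hsx
    have h1 : Leaf.pt q = D.cycℓ hι hC hv hmem hω hα i w := hι.injective (by rw [hq, h]; rfl)
    have h2 : F.leaf (Leaf.pt q) = F.leaf (sx k) := leaf_eq_of_mem q.2
    rw [← h2, h1]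
    exact leaf_eq_of_mem (D.cycℓ_mem_leaf hι hC hv hmem hω hα i w)
  subst hk
  -- then it is a point of the incoming arc of the piece `i`
  set u' : I := ⟨1 - b / E.β, by
    have hβ := E.hβin.1
    constructor
    · rw [sub_nonneg, div_le_one hβ]; exact hb.2
    · have : 0 < b / E.β := div_pos hb.1 hβ
      linarith⟩ with hu'
  have hin : D.inArc hι hC hv hmem hω hα i u' = (D.star (vtx (i + 1)) (D.nprong_vtx_ne_zero hC hv hmem hω (i + 1) (hbi := hbi))).pt E.Ef.j (b, 0) := by
    show (D.star (vtx (i + 1)) _).pt E.Ef.j ((1 - (1 - b / E.β)) * E.β, 0) = _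
    congr 2
    rw [sub_sub_cancel, div_mul_cancel₀ b E.hβin.1.ne']
  have key := D.linkArc_eq_inArc hι hC hv hmem hω hα i (u := w) (u' := u') (by rw [hin, h])
  have : (w : ℝ) = 1 := by rw [key.1]; rfl
  linarith

include hsx in
/-- **Outgoing prong points are not interior points of a link** (other than its start). [folklore] -/
theorem outPt_ne_linkArc (k : Fin m) {b : ℝ} (hb : b ∈ Ioc 0 (D.jc hι hC hv hmem hω hα k).β) {w : I} (hw : 0 < (w : ℝ)) :
    (D.star (vtx k) (D.nprong_vtx_ne_zero hC hv hmem hω k (hbi := hbi))).pt (D.jc hι hC hv hmem hω hα k).Eb.j (b, 0) ≠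
      D.linkArc hι hC hv hmem hω hα i w := by
  intro h
  set E := D.jc hι hC hv hmem hω hα k with hE
  obtain ⟨q, -, hq⟩ := E.Eb.exists_mem_bwd hι (β := b) ⟨hb.1, hb.2.trans E.hβout.2⟩
  have hk : k + 1 = i + 1 := by
    apply hsx
    have h1 : Leaf.pt q = D.cycℓ hι hC hv hmem hω hα i w := hι.injective (by rw [hq, h]; rfl)
    have h2 : F.leaf (Leaf.pt q) = F.leaf (sx (k + 1)) := leaf_eq_of_mem q.2
    rw [← h2, h1]
    exact leaf_eq_of_mem (D.cycℓ_mem_leaf hι hC hv hmem hω hα i w)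
  have hk' : k = i := add_right_cancel hk
  subst hk'
  set u : I := ⟨b / E.β, by
    have hβ := E.hβin.1
    exact ⟨(div_pos hb.1 hβ).le, (div_le_one hβ).2 hb.2⟩⟩ with hu
  have hout : D.outArc hι hC hv hmem hω hα k u = (D.star (vtx k) (D.nprong_vtx_ne_zero hC hv hmem hω k (hbi := hbi))).pt E.Eb.j (b, 0) := by
    show (D.star (vtx k) _).pt E.Eb.j (b / E.β * E.β, 0) = _
    congr 2
    rw [div_mul_cancel₀ b E.hβin.1.ne']
  have key := D.outArc_eq_linkArc hι hC hv hmem hω hα k (u := u) (u' := w) (by rw [hout, h])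
  have : (w : ℝ) = 0 := by rw [key.2]; rfl
  linarith

include hsx in
/-- **Different links do not meet.** [folklore] -/
theorem linkArc_ne_linkArc {k : Fin m} (hk : k ≠ i) (θ w : I) : D.linkArc hι hC hv hmem hω hα k θ ≠ D.linkArc hι hC hv hmem hω hα i w := by
  intro h
  have h1 : D.cycℓ hι hC hv hmem hω hα k θ = D.cycℓ hι hC hv hmem hω hα i w := hι.injective h
  have : k + 1 = i + 1 := by
    apply hsx
    rw [← leaf_eq_of_mem (D.cycℓ_mem_leaf hι hC hv hmem hω hα k θ), h1]
    exact leaf_eq_of_mem (D.cycℓ_mem_leaf hι hC hv hmem hω hα i w)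
  exact hk (add_right_cancel this)

include hsx in
/-- **Gate points are not interior points of a link.** [folklore] -/
theorem gatePlaneBase_ne_linkArc (k : Fin m) (θ : I) {w : I} (hw0 : 0 < (w : ℝ)) (hw1 : (w : ℝ) < 1) :
    D.gatePlaneBase (D.cycJ hι hC hv hmem hω hα k).hv (D.cycJ hι hC hv hmem hω hα k).jin (D.cycJ hι hC hv hmem hω hα k).jout
      (D.cycJ hι hC hv hmem hω hα k).β θ ≠ D.linkArc hι hC hv hmem hω hα i w := by
  rcases D.gatePlaneBase_cases (D.cycJ hι hC hv hmem hω hα k).hv (D.cycJ hι hC hv hmem hω hα k).jin (D.cycJ hι hC hv hmem hω hα k).jout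
      (D.cycJ hι hC hv hmem hω hα k).hβ.1 θ with h | ⟨b, hb, h⟩ | ⟨b, hb, h⟩
  · rw [h]; exact (D.vtx_ne_ι hv k _).symm
  · rw [h]; exact D.inPt_ne_linkArc hι hC hv hmem hω hα hsx i k hb hw1
  · rw [h]; exact D.outPt_ne_linkArc hι hC hv hmem hω hα hsx i k hb hw0

end Meetings

/-! ## The last link and the rest of the trace -/

section Last

variable {n : ℕ} [NeZero (n + 1)] {vtx' : Fin (n + 1) → ℂ} {sx' : Fin (n + 1) → X} [hnc' : ∀ i, NoncompactSpace (F.Leaf (sx' i))]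
  (hv' : ∀ i, vtx' i ∈ D.P) (hmem' : ∀ i, ∀ q : F.Leaf (sx' i), ι (Leaf.pt q) ∈ C)
  (hω' : ∀ i, omegaSet hbi ι (sx' i) = {vtx' i}) (hα' : ∀ i, alphaSet hbi ι (sx' (i + 1)) = {vtx' i})
  (hsx' : ∀ a b, F.leaf (sx' a) = F.leaf (sx' b) → a = b)

omit [T2Space X] [SecondCountableTopology X] [Nonempty X] in
/-- The index of the last junction of a period. [folklore] -/
theorem idx_last_val : ((idx (n + 1) n : Fin (n + 1)) : ℕ) = n := Nat.mod_eq_of_lt n.lt_succ_self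

include hsx' in
/-- **The values of the trace off the middle of the last link are not interior points of the last
link.** [folklore] -/
theorem walkPlaneBase_ne_linkArc_last {θ : I} (hθ : (θ : ℝ) ∉ Ioo (5 / 8 : ℝ) (3 / 4)) {w : I} (hw0 : 0 < (w : ℝ)) (hw1 : (w : ℝ) < 1) :
    walkPlaneBase (D.walkJ hι hC hv' hmem' hω' hα') (D.walkℓ hι hC hv' hmem' hω' hα') (n + 1) θ ≠
      D.linkArc hι hC hv' hmem' hω' hα' (idx (n + 1) n) w := by
  set J := D.walkJ hι hC hv' hmem' hω' hα' with hJ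
  set ℓw := D.walkℓ hι hC hv' hmem' hω' hα' with hℓw
  have hlink : ∀ (k : ℕ) (φ : I), ι (ℓw k φ) = D.linkArc hι hC hv' hmem' hω' hα' (idx (n + 1) k) φ := fun k φ ↦ rfl
  rcases D.walkPlaneBase_succ_mem_of_not_mem (J := J) (ℓ := ℓw) n hθ with (⟨θ', hθ'⟩ | hgate) | hend
  · -- a value of the trace up to the junction `n`
    rw [← hθ']
    rcases D.walkPlaneBase_mem (J := J) (ℓ := ℓw) n θ' with h0 | ⟨k, hk, hk'⟩
    · rw [h0]
      exact D.inPt_ne_linkArc hι hC hv' hmem' hω' hα' hsx' _ (idx (n + 1) 0) (b := (D.jc hι hC hv' hmem' hω' hα' (idx (n + 1) 0)).β)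
        ⟨(D.jc hι hC hv' hmem' hω' hα' _).hβin.1, le_rfl⟩ hw1
    · rcases hk' with hg | ⟨y, ⟨φ, rfl⟩, hy⟩
      · obtain ⟨φ, hφ⟩ := hg
        rw [← hφ]
        exact D.gatePlaneBase_ne_linkArc hι hC hv' hmem' hω' hα' hsx' _ (idx (n + 1) k) φ hw0 hw1
      · rw [← hy, hlink]
        refine D.linkArc_ne_linkArc hι hC hv' hmem' hω' hα' hsx' _ (fun h ↦ ?_) φ w
        have h1 := congrArg Fin.val h
        rw [idx_val, idx_val, Nat.mod_eq_of_lt (hk.trans n.lt_succ_self), Nat.mod_eq_of_lt n.lt_succ_self] at h1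
        exact hk.ne h1
  · obtain ⟨φ, hφ⟩ := hgate
    rw [← hφ]
    exact D.gatePlaneBase_ne_linkArc hι hC hv' hmem' hω' hα' hsx' _ (idx (n + 1) n) φ hw0 hw1
  · -- the ends of the last link
    rcases hend with h | h
    · rw [h, ← (ℓw n).source, hlink]
      intro h'
      have := D.injective_cycℓ hι hC hv' hmem' hω' hα' _ (hι.injective h')
      have : (w : ℝ) = 0 := by rw [← this]; rfl
      linarith
    · rw [h, ← (ℓw n).target, hlink]
      intro h'
      have := D.injective_cycℓ hι hC hv' hmem' hω' hα' _ (hι.injective h')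
      have : (w : ℝ) = 1 := by rw [← this]; rfl
      linarith

end Last

/-! ## The straight piece -/

set_option maxHeartbeats 1600000 in
include hsx in
/-- **A straight piece on the trace loop of the walk around a cycle of distinct separatrices**,
read in a reparametrisation `e'` of a chart `e` of the atlas with the same plaques, the test points
being plaque points of `e`. See the module docstring. [folklore] -/
theorem exists_straightPiece (hωc : Continuous (traceLoop (D.walkJ hι hC hv hmem hω hα) (D.walkℓ hι hC hv hmem hω hα) m)) :
    ∃ (e : OpenPartialHomeomorph X (ℝ × ℝ)) (_ : e ∈ F.atlas) (e' : OpenPartialHomeomorph X (ℝ × ℝ)) (_ : e'.target = univ)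
      (P : StraightPiece ι e' (traceLoop (D.walkJ hι hC hv hmem hω hα) (D.walkℓ hι hC hv hmem hω hα) m)) (a : ℝ),
      ∀ ρ, P.pt ρ = ι (e.symm (a, P.h₀ + ρ)) := by
  -- write `m = n + 1`
  obtain ⟨n, rfl⟩ : ∃ n, m = n + 1 := ⟨m - 1, (Nat.sub_add_cancel NeZero.one_le).symm⟩
  set J := D.walkJ hι hC hv hmem hω hα with hJ
  set ℓw := D.walkℓ hι hC hv hmem hω hα with hℓw
  set last : Fin (n + 1) := idx (n + 1) n with hlast
  set L := D.cycℓ hι hC hv hmem hω hα last with hL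
  have hper : J (n + 1) = J 0 := D.walkJ_period hι hC hv hmem hω hα
  have hlink : ∀ φ : I, ℓw n φ = L φ := fun φ ↦ rfl
  -- the link extended to `ℝ`
  set c : ℝ → X := fun u ↦ L (projIcc 0 1 zero_le_one u) with hc
  have hcL : Continuous (toLeafSpace ∘ c : ℝ → F.LeafSpace) :=
    (D.continuous_toLeafSpace_cycℓ hι hC hv hmem hω hα last).comp continuous_projIcc
  have hcM : Continuous c := F.continuous_of_continuous_toLeafSpace hcL
  have hcinj : InjOn c (Icc 0 1) := fun u hu u' hu' h ↦ by
    have := D.injective_cycℓ hι hC hv hmem hω hα last h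
    rw [projIcc_of_mem _ hu, projIcc_of_mem _ hu'] at this
    exact congrArg Subtype.val this
  have hcapply : ∀ {u : ℝ} (hu : u ∈ Icc (0 : ℝ) 1), c u = L ⟨u, hu⟩ := fun hu ↦ by
    show L (projIcc 0 1 zero_le_one _) = _; rw [projIcc_of_mem _ hu]
  -- a chart at the midpoint, and a monotone plaque sub-arc
  have hhalf : (1 / 2 : ℝ) ∈ Ioo (0 : ℝ) 1 := ⟨by norm_num, by norm_num⟩
  obtain ⟨e, he, hxe⟩ := F.exists_mem_source (c (1 / 2))
  obtain ⟨δ, hδ, hδS, hplaque, hmono⟩ := exists_strictMonoOn_or_strictAntiOn (S := Ioo 0 1) hcL isOpen_Ioo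
    (hcinj.mono Ioo_subset_Icc_self) he hhalf hxe
  set A : ℝ → ℝ := fun u ↦ (e (c u)).1 with hA
  set h₀ := (e (c (1 / 2))).2 with hh₀
  have hw01 : Icc (1 / 2 - δ) (1 / 2 + δ) ⊆ Ioo 0 1 := hδS
  have hcplaque : ∀ {w : ℝ}, w ∈ Icc (1 / 2 - δ) (1 / 2 + δ) → c w = e.symm (A w, h₀) := by
    intro w hw
    have h1 : h₀ = (e (c w)).2 := (hplaque w hw).2.symm
    rw [h1]
    show c w = e.symm ((e (c w)).1, (e (c w)).2)
    rw [Prod.mk.eta]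
    exact (e.left_inv (hplaque w hw).1).symm
  set w₁ : ℝ := 1 / 2 - δ / 2 with hw₁
  set w₂ : ℝ := 1 / 2 + δ / 2 with hw₂
  have hw12 : w₁ < w₂ := by rw [hw₁, hw₂]; linarith
  have hwI : Icc w₁ w₂ ⊆ Icc (1 / 2 - δ) (1 / 2 + δ) := Icc_subset_Icc (by rw [hw₁]; linarith) (by rw [hw₂]; linarith)
  have hcont : ContinuousOn A (Icc (1 / 2 - δ) (1 / 2 + δ)) :=
    continuous_fst.comp_continuousOn (e.continuousOn.comp hcM.continuousOn fun u hu ↦ (hplaque u hu).1)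
  obtain ⟨φ, hφA, hφimg⟩ := exists_homeomorph_eqOn hw12 (hcont.mono hwI) (hmono.imp (fun h ↦ h.mono hwI) (fun h ↦ h.mono hwI))
  set a₁ := min (A w₁) (A w₂) with ha₁
  set a₂ := max (A w₁) (A w₂) with ha₂
  -- the abscissae of the sub-arc beyond `[w₁, w₂]` are not strictly between `A w₁` and `A w₂`
  have hAout : ∀ {w : ℝ}, w ∈ Icc (1 / 2 - δ) (1 / 2 + δ) → w ∉ Ioo w₁ w₂ → A w ∉ Ioo a₁ a₂ := by
    intro w hw hwn hAw
    rcases hmono with hM | hM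
    · have h12 : A w₁ < A w₂ := hM (hwI ⟨le_rfl, hw12.le⟩) (hwI ⟨hw12.le, le_rfl⟩) hw12
      rw [ha₁, ha₂, min_eq_left h12.le, max_eq_right h12.le] at hAw
      rcases le_or_gt w w₁ with h | h
      · exact (hM.monotoneOn hw (hwI ⟨le_rfl, hw12.le⟩) h).not_gt hAw.1
      · have h' : w₂ ≤ w := not_lt.1 fun h' ↦ hwn ⟨h, h'⟩
        exact (hM.monotoneOn (hwI ⟨hw12.le, le_rfl⟩) hw h').not_gt hAw.2
    · have h12 : A w₂ < A w₁ := hM (hwI ⟨le_rfl, hw12.le⟩) (hwI ⟨hw12.le, le_rfl⟩) hw12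
      rw [ha₁, ha₂, min_eq_right h12.le, max_eq_left h12.le] at hAw
      rcases le_or_gt w w₁ with h | h
      · exact (hM.antitoneOn hw (hwI ⟨le_rfl, hw12.le⟩) h).not_gt hAw.2
      · have h' : w₂ ≤ w := not_lt.1 fun h' ↦ hwn ⟨h, h'⟩
        exact (hM.antitoneOn (hwI ⟨hw12.le, le_rfl⟩) hw h').not_gt hAw.1
  -- the reparametrised chart, in which the sub-arc is a horizontal segment
  set e' := reparamChart e φ with he'
  have he'univ : e'.target = univ := reparamChart_target e φ (F.target_eq e he)
  have hseg : ∀ w ∈ Icc w₁ w₂, e'.symm (w, h₀) = c w := fun w hw ↦ by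
    rw [reparamChart_symm_apply, hφA hw]
    exact (hcplaque (hwI hw)).symm
  -- injectivity of `e.symm` (target the whole plane)
  have hesymm : ∀ {q q' : ℝ × ℝ}, e.symm q = e.symm q' → q = q' := fun {q q'} h ↦ by
    have h1 := congrArg e h
    rwa [e.right_inv (by rw [F.target_eq e he]; exact mem_univ _), e.right_inv (by rw [F.target_eq e he]; exact mem_univ _)] at h1
  -- the trace parameters of the segment
  set t₁ : ℝ := (w₁ + 5) / 8 with ht₁
  set t₂ : ℝ := (w₂ + 5) / 8 with ht₂
  have hw₁0 : 0 < w₁ := (hw01 (hwI ⟨le_rfl, hw12.le⟩)).1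
  have hw₂1 : w₂ < 1 := (hw01 (hwI ⟨hw12.le, le_rfl⟩)).2
  have ht12 : t₁ < t₂ := by rw [ht₁, ht₂]; linarith
  -- the trace on `[5/8, 3/4]` is the last link
  have htrace : ∀ {t : ℝ}, t ∈ Icc (5 / 8 : ℝ) (3 / 4) → traceLoop J ℓw (n + 1) t = ι (c (8 * t - 5)) := by
    intro t ht
    have ht01 : t ∈ Icc (0 : ℝ) 1 := ⟨by linarith [ht.1], by linarith [ht.2]⟩
    rw [traceLoop_apply_of_mem hper ht01, projIcc_of_mem _ ht01, walkPlaneBase_succ_apply_of_mem (J := J) (ℓ := ℓw) n (θ := ⟨t, ht01⟩) ht,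
      hlink, hcapply ⟨by linarith [ht.1], by linarith [ht.2]⟩]
    rfl
  -- the rest of the trace, and the closed segment
  set w₀ : ℝ := 1 / 2 - 3 * δ / 4 with hw₀
  set w₃ : ℝ := 1 / 2 + 3 * δ / 4 with hw₃
  set s₁ : ℝ := (w₀ + 5) / 8 with hs₁
  set s₂ : ℝ := (w₃ + 5) / 8 with hs₂
  have hδ1 : δ < 1 / 2 := by
    have := (hw01 ⟨le_rfl, by linarith⟩ : (1 / 2 - δ : ℝ) ∈ Ioo 0 1).1; linarith
  set Rset : Set ℂ := traceLoop J ℓw (n + 1) '' Icc s₂ (s₁ + 1) with hRset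
  set seg : Set ℂ := (fun w ↦ ι (c w)) '' Icc w₁ w₂ with hseg'
  have hRc : IsCompact Rset := isCompact_Icc.image hωc
  have hsegc : IsCompact seg := isCompact_Icc.image (hι.continuous.comp hcM)
  -- the values of the trace at parameters off `(s₁, s₂)` are off the open sub-arc
  have key : ∀ θ : I, ((θ : ℝ) ≤ s₁ ∨ s₂ ≤ (θ : ℝ)) → ∀ {w : ℝ}, w ∈ Icc w₁ w₂ →
      walkPlaneBase J ℓw (n + 1) θ ≠ ι (c w) := by
    intro θ hθ w hw heq
    have hw0 : 0 < w := by linarith [hw.1]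
    have hw1 : w < 1 := by linarith [hw.2]
    have hwI01 : w ∈ Icc (0 : ℝ) 1 := ⟨hw0.le, hw1.le⟩
    by_cases hθI : (θ : ℝ) ∈ Ioo (5 / 8 : ℝ) (3 / 4)
    · -- in the slot of the last link, off `(w₀, w₃)`
      have hθc : (θ : ℝ) ∈ Icc (5 / 8 : ℝ) (3 / 4) := ⟨hθI.1.le, hθI.2.le⟩
      have h8 : (8 * θ - 5 : ℝ) ∈ Icc (0 : ℝ) 1 := ⟨by linarith [hθc.1], by linarith [hθc.2]⟩
      rw [walkPlaneBase_succ_apply_of_mem (J := J) (ℓ := ℓw) n hθc, hlink] at heq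
      have hLc : L (linkParam θ hθc) = c (8 * θ - 5) := by rw [hcapply h8]; exact congrArg L (Subtype.ext rfl)
      rw [hLc] at heq
      have h1 : (8 * θ - 5 : ℝ) = w := hcinj h8 hwI01 (hι.injective heq)
      rcases hθ with hθ | hθ
      · have : (8 * θ - 5 : ℝ) ≤ w₀ := by rw [hs₁] at hθ; linarith
        rw [h1] at this; rw [hw₀] at this; rw [hw₁] at hw; linarith [hw.1]
      · have : w₃ ≤ (8 * θ - 5 : ℝ) := by rw [hs₂] at hθ; linarith
        rw [h1] at this; rw [hw₃] at this; rw [hw₂] at hw; linarith [hw.2]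
    · rw [hcapply hwI01] at heq
      exact D.walkPlaneBase_ne_linkArc_last hι hC hv hmem hω hα hsx hθI (w := ⟨w, hwI01⟩) hw0 hw1 heq
  have hdisj : Disjoint Rset seg := by
    rw [disjoint_left]
    rintro z ⟨t, ht, rfl⟩ ⟨w, hw, hzw⟩
    have hs₂pos : 0 ≤ s₂ := by rw [hs₂, hw₃]; linarith
    have hs₁1 : s₁ < 1 := by rw [hs₁, hw₀]; linarith
    rcases le_or_gt t 1 with ht1 | ht1
    · have ht01 : t ∈ Icc (0 : ℝ) 1 := ⟨hs₂pos.trans ht.1, ht1⟩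
      rw [traceLoop_apply_of_mem hper ht01, projIcc_of_mem _ ht01] at hzw
      exact key ⟨t, ht01⟩ (Or.inr ht.1) hw hzw.symm
    · have ht01 : t - 1 ∈ Icc (0 : ℝ) 1 := ⟨by linarith, by linarith [ht.2]⟩
      have hper1 : traceLoop J ℓw (n + 1) t = traceLoop J ℓw (n + 1) (t - 1) := by
        have := periodic_traceLoop (J := J) (ℓ := ℓw) (n + 1) (t - 1)
        rwa [sub_add_cancel] at this
      rw [hper1, traceLoop_apply_of_mem hper ht01, projIcc_of_mem _ ht01] at hzw
      exact key ⟨t - 1, ht01⟩ (Or.inl (by linarith [ht.2])) hw hzw.symm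
  obtain ⟨dth, hdth, hdisjth⟩ := hdisj.exists_thickenings hRc hsegc.isClosed
  have hfar : ∀ z ∈ Rset, ∀ z' ∈ seg, dth ≤ dist z z' := by
    intro z hz z' hz'
    by_contra hlt
    push Not at hlt
    exact disjoint_left.1 hdisjth (self_subset_thickening hdth _ hz) (mem_thickening_iff.2 ⟨z', hz', hlt⟩)
  -- a thin box around the segment stays within `dth` of the segment
  set Φ : ℝ × ℝ → ℂ := fun q ↦ ι (e.symm q) with hΦ
  have hΦc : Continuous Φ := by
    have : ContinuousOn e.symm univ := by rw [← F.target_eq e he]; exact e.continuousOn_symm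
    exact hι.continuous.comp (continuousOn_univ.1 this)
  set nset : Set (ℝ × ℝ) := {q | dist (Φ q) (Φ (q.1, h₀)) < dth} with hnset
  have hnopen : IsOpen nset :=
    isOpen_lt (continuous_dist.comp (hΦc.prodMk (hΦc.comp (continuous_fst.prodMk continuous_const)))) continuous_const
  have hsub : Icc a₁ a₂ ×ˢ ({h₀} : Set ℝ) ⊆ nset := by
    rintro ⟨a, h⟩ ⟨-, hh⟩
    have hh' : h = h₀ := hh
    show dist (Φ (a, h)) (Φ (a, h₀)) < dth
    rw [hh', dist_self]; exact hdth
  obtain ⟨uu, vv, -, hvv, huu, hvvh, huv⟩ := generalized_tube_lemma isCompact_Icc isCompact_singleton hnopen hsub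
  obtain ⟨r₀, hr₀, hball⟩ := Metric.isOpen_iff.1 hvv h₀ (hvvh (mem_singleton _))
  set r := min r₀ 1 with hr
  have hrpos : 0 < r := lt_min hr₀ one_pos
  -- the straight piece
  have hstraight : ∀ u ∈ Icc (0 : ℝ) 1, traceLoop J ℓw (n + 1) (t₁ + u * (t₂ - t₁)) = ι (e'.symm (w₁ + u * (w₂ - w₁), h₀)) := by
    intro u hu
    have hlow : 0 ≤ u * (w₂ - w₁) := mul_nonneg hu.1 (sub_nonneg.2 hw12.le)
    have hup : u * (w₂ - w₁) ≤ w₂ - w₁ := mul_le_of_le_one_left (sub_nonneg.2 hw12.le) hu.2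
    have hwu : w₁ + u * (w₂ - w₁) ∈ Icc w₁ w₂ := ⟨by linarith, by linarith⟩
    have hrel : t₁ + u * (t₂ - t₁) = (w₁ + u * (w₂ - w₁) + 5) / 8 := by rw [ht₁, ht₂]; ring
    have htu : t₁ + u * (t₂ - t₁) ∈ Icc (5 / 8 : ℝ) (3 / 4) := by
      rw [hrel]; constructor <;> linarith [hwu.1, hwu.2]
    rw [htrace htu, hseg _ hwu, hrel]
    congr 2
    ring
  have haway : ∀ t ∈ Icc t₂ (t₁ + 1), traceLoop J ℓw (n + 1) t ∉
      (fun q : ℝ × ℝ ↦ ι (e'.symm q)) '' (Ioo w₁ w₂ ×ˢ Ioo (h₀ - r) (h₀ + r)) := by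
    intro t ht
    rintro ⟨q, ⟨hq1, hq2⟩, hqz⟩
    -- read in the chart `e`
    have ha : φ q.1 ∈ Ioo a₁ a₂ := by rw [← hφimg]; exact ⟨q.1, hq1, rfl⟩
    have hqz' : traceLoop J ℓw (n + 1) t = Φ (φ q.1, q.2) := hqz.symm
    have hq2' : q.2 ∈ Ioo (h₀ - r) (h₀ + r) := hq2
    -- the three ranges of `t`
    by_cases htR : t ∈ Icc s₂ (s₁ + 1)
    · -- the rest of the trace: at distance `≥ dth` from the segment, but the box is `dth`-close
      have hzR : traceLoop J ℓw (n + 1) t ∈ Rset := ⟨t, htR, rfl⟩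
      obtain ⟨w', hw', hφw'⟩ : ∃ w' ∈ Ioo w₁ w₂, φ w' = φ q.1 := ⟨q.1, hq1, rfl⟩
      have hzσ : Φ (φ q.1, h₀) ∈ seg := by
        refine ⟨w', ⟨hw'.1.le, hw'.2.le⟩, ?_⟩
        show ι (c w') = ι (e.symm (φ q.1, h₀))
        rw [← hseg w' ⟨hw'.1.le, hw'.2.le⟩, reparamChart_symm_apply, hφw']
      have hclose : dist (Φ (φ q.1, q.2)) (Φ (φ q.1, h₀)) < dth := by
        have hmem : ((φ q.1, q.2) : ℝ × ℝ) ∈ uu ×ˢ vv :=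
          ⟨huu ⟨ha.1.le, ha.2.le⟩, hball (by rw [Metric.mem_ball, Real.dist_eq, abs_lt]; constructor <;>
            linarith [hq2'.1, hq2'.2, min_le_left r₀ 1])⟩
        exact huv hmem
      have := hfar _ hzR _ hzσ
      rw [hqz'] at this
      exact this.not_gt hclose
    · -- next to the segment, on the plaque: the abscissa is off `(a₁, a₂)`
      have hcases : (t ∈ Ico t₂ s₂) ∨ (t ∈ Ioc (s₁ + 1) (t₁ + 1)) := by
        rcases lt_or_ge t s₂ with h | h
        · exact Or.inl ⟨ht.1, h⟩
        · right
          refine ⟨not_le.1 fun h' ↦ htR ⟨h, h'⟩, ht.2⟩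
      -- a parameter `w` of the sub-arc off `(w₁, w₂)` with `traceLoop t = ι (c w)`
      obtain ⟨w, hwδ, hwn, hzw⟩ : ∃ w ∈ Icc (1 / 2 - δ) (1 / 2 + δ), w ∉ Ioo w₁ w₂ ∧ traceLoop J ℓw (n + 1) t = ι (c w) := by
        rcases hcases with h | h
        · refine ⟨8 * t - 5, ⟨?_, ?_⟩, fun h' ↦ ?_, htrace ⟨?_, ?_⟩⟩
          · rw [ht₂, hw₂] at h; linarith [h.1]
          · rw [hs₂, hw₃] at h; linarith [h.2]
          · rw [ht₂] at h; linarith [h.1, h'.2]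
          · rw [ht₂, hw₂] at h; linarith [h.1]
          · rw [hs₂, hw₃] at h; linarith [h.2]
        · have hper1 : traceLoop J ℓw (n + 1) t = traceLoop J ℓw (n + 1) (t - 1) := by
            have := periodic_traceLoop (J := J) (ℓ := ℓw) (n + 1) (t - 1)
            rwa [sub_add_cancel] at this
          refine ⟨8 * (t - 1) - 5, ⟨?_, ?_⟩, fun h' ↦ ?_, ?_⟩
          · rw [hs₁, hw₀] at h; linarith [h.1]
          · rw [ht₁, hw₁] at h; linarith [h.2]
          · rw [ht₁] at h; linarith [h.2, h'.1]
          · rw [hper1]; exact htrace ⟨by rw [hs₁, hw₀] at h; linarith [h.1], by rw [ht₁, hw₁] at h; linarith [h.2]⟩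
      rw [hzw, hcplaque hwδ] at hqz'
      have heq : (A w, h₀) = (φ q.1, q.2) := hesymm (hι.injective hqz')
      have h1 : A w = φ q.1 := congrArg Prod.fst heq
      exact hAout hwδ hwn (by rw [h1]; exact ha)
  have ht₁0 : 0 ≤ t₁ := by rw [ht₁]; linarith
  have ht₂1 : t₂ ≤ 1 := by rw [ht₂]; linarith
  let P : StraightPiece ι e' (traceLoop J ℓw (n + 1)) :=
    { t₁ := t₁, t₂ := t₂, b₁ := w₁, b₂ := w₂, h₀ := h₀, r := r
      ht₁ := ht₁0
      ht₁₂ := ht12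
      ht₂ := ht₂1
      hb := hw12
      hr := hrpos
      straight := hstraight
      away := haway }
  refine ⟨e, he, e', he'univ, P, φ ((w₁ + w₂) / 2), fun ρ ↦ ?_⟩
  show ι (e'.symm ((w₁ + w₂) / 2, h₀ + ρ)) = ι (e.symm (φ ((w₁ + w₂) / 2), h₀ + ρ))
  rw [he', reparamChart_symm_apply]

end StarData

end Literature.Topology.PlanarFoliations
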